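import Mathlib.Analysis.Calculus.ContDiff.Operations
import Mathlib.Analysis.Calculus.ContDiff.RCLike
import Mathlib.MeasureTheory.Integral.IntervalIntegral.AbsolutelyContinuousFun
import Mathlib.MeasureTheory.Integral.Prod
import Mathlib.MeasureTheory.Integral.DominatedConvergence
import Mathlib.MeasureTheory.Group.Integral
import Literature.Analysis.PDE.BurgersHopfLaxPotential
import HarnessLib

/-!
# The Lax–Hopf formula for Burgers' equation, III: the weak form and continuity in time

Continuation of `BurgersHopfLax.lean` / `BurgersHopfLaxPotential.lean`. For bounded measurable
data `|u₀| ≤ M`, Hopf's solution `u = hopfSolution u₀` (`u(t,x) = (x - y₊(t,x))/t`) is shown to be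

* **continuous in time in the weak sense**: `s ↦ ∫_S φ(x) u(s,x) dx` is continuous on `(0,∞)`
  for every `φ` integrable on `S` (`continuousOn_setIntegral_mul_hopfSolution`; this is the part
  of Dafermos (6.2.7), `u ∈ C⁰([0,∞); L¹_loc)`, used downstream) — from finite speed of
  propagation of `y₊` (`laxMinimizer_mono`) at the continuity points of the monotone `y₊(s₀,·)`;
* **a weak solution of the Cauchy problem** with `C¹` compactly supported test functions
  (`hopfSolution_weakForm`, Hörmander (2.4.1)′ / Thm 2.4.2, Dafermos (4.1.6)):
  `∬_{t>0} (u ∂ₜψ + ½ u² ∂ₓψ) dx dt + ∫ u₀(x) ψ(0,x) dx = 0`.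

Proof of the weak form (a variant of Evans §3.4.2 Thm 1 that needs neither mollifiers nor second
derivatives of the test function): with the Hopf–Lax potential `W` (`W(0,·) = U₀ = ∫₀ u₀`,
`∂ₓ⁺W = u` everywhere, `∂ₜW = -u²/2` a.e. on each line `x = const`),
`∬ D_h W ∂ₜψ = ∬ W ∂ₜΦ_h = ∫_x (-U₀ Φ_h(0,·) + ∫_{t>0} (u²/2) Φ_h)` for the difference quotient
`D_hW = (W(t,x+h)-W(t,x))/h` and `Φ_h = (ψ(t,x-h)-ψ(t,x))/h` (translation invariance, Fubini, and
integration by parts in `t` for the absolutely continuous `t ↦ W(t,x)`,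
`AbsolutelyContinuousOnInterval.integral_mul_deriv_eq_deriv_mul`); then `h = 1/(n+1) → 0` by
dominated convergence, and `∫ U₀ ∂ₓψ(0,·) = -∫ u₀ ψ(0,·)` by parts and Lebesgue differentiation
(`IntervalIntegrable.ae_hasDerivAt_integral`).

Relation to `Literature/Analysis/PDE/BurgersEntropySolutionsProofs.lean` (namespace `HopfLax`,
discharge of `hormander_hopfSolution_exists`): that file verifies Hörmander's (2.4.1)′ for the
right derivative of an abstract value function (hypothesis style, `C_c^∞` tests, Rademacher in
`ℝ²`). The present files work with the concrete largest minimizer `y₊ = laxMinimizer` and add what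
the periodic problem on the circle needs and (2.4.1)′ does not give: a representative defined
EVERYWHERE with condition E pointwise and `x`-periodicity, `C¹` test functions, and continuity
in time.

## References

* L. Hörmander, *Lectures on Nonlinear Hyperbolic Differential Equations* (1997), §2.4
  (2.4.1)′, Thm 2.4.2. [Hormander1997]
* C. M. Dafermos, *Hyperbolic Conservation Laws in Continuum Physics*, 2nd ed. (2005), (4.1.6),
  Thm 6.2.1 (6.2.7), §11.4. [Dafermos2005]
* L. C. Evans, *Partial Differential Equations*, 2nd ed. (2010), §3.4.2 Thm 1. [Evans2010]
-/

noncomputable section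

open Set Filter MeasureTheory intervalIntegral
open scoped Topology

namespace Literature.Analysis.PDE

variable {u₀ : ℝ → ℝ} {M : ℝ}

/-! ### Continuity in time -/

/-- **The minimizer map is continuous in `t` at every continuity point of `y₊(s₀,·)`**:
squeeze `y₊(s₀, x - M|s - s₀|) ≤ y₊(s,x) ≤ y₊(s₀, x + M|s - s₀|)` (finite speed of propagation,
`laxMinimizer_mono`). [folklore] -/
theorem continuousAt_laxMinimizer_t (hm : Measurable u₀) (hM : ∀ x, |u₀ x| ≤ M) {s₀ : ℝ}
    (hs₀ : 0 < s₀) {x : ℝ} (hx : ContinuousAt (laxMinimizer u₀ s₀) x) :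
    ContinuousAt (fun s => laxMinimizer u₀ s x) s₀ := by
  have hlo : ∀ s, 0 < s → laxMinimizer u₀ s₀ (x - M * |s - s₀|) ≤ laxMinimizer u₀ s x :=
    fun s hs => laxMinimizer_mono hm hM hs₀ hs (by linarith)
  have hhi : ∀ s, 0 < s → laxMinimizer u₀ s x ≤ laxMinimizer u₀ s₀ (x + M * |s - s₀|) :=
    fun s hs => laxMinimizer_mono hm hM hs hs₀ (by rw [abs_sub_comm])
  have harg : Tendsto (fun s => M * |s - s₀|) (𝓝 s₀) (𝓝 0) := by
    have h : Continuous fun s : ℝ => M * |s - s₀| := by fun_prop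
    simpa using h.tendsto s₀
  have h1 : Tendsto (fun s => laxMinimizer u₀ s₀ (x - M * |s - s₀|)) (𝓝 s₀)
      (𝓝 (laxMinimizer u₀ s₀ x)) :=
    hx.tendsto.comp (by simpa using tendsto_const_nhds.sub harg)
  have h2 : Tendsto (fun s => laxMinimizer u₀ s₀ (x + M * |s - s₀|)) (𝓝 s₀)
      (𝓝 (laxMinimizer u₀ s₀ x)) :=
    hx.tendsto.comp (by simpa using tendsto_const_nhds.add harg)
  refine tendsto_of_tendsto_of_tendsto_of_le_of_le' h1 h2 ?_ ?_
  · filter_upwards [Ioi_mem_nhds hs₀] with s hs using hlo s hs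
  · filter_upwards [Ioi_mem_nhds hs₀] with s hs using hhi s hs

/-- Hopf's solution is continuous in `t` at `(s₀, x)` whenever `y₊(s₀,·)` is continuous at `x`
(Hörmander Thm 2.4.2: "`u` is continuous in `(t,x)` where the minimum point is unique").
[cite: Hormander1997, Thm 2.4.2] -/
theorem continuousAt_hopfSolution_t (hm : Measurable u₀) (hM : ∀ x, |u₀ x| ≤ M) {s₀ : ℝ}
    (hs₀ : 0 < s₀) {x : ℝ} (hx : ContinuousAt (laxMinimizer u₀ s₀) x) :
    ContinuousAt (fun s => hopfSolution u₀ s x) s₀ := by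
  have h := continuousAt_laxMinimizer_t hm hM hs₀ hx
  have h' : ContinuousAt (fun s => (x - laxMinimizer u₀ s x) / s) s₀ :=
    (continuousAt_const.sub h).div continuousAt_id hs₀.ne'
  refine h'.congr ?_
  filter_upwards [Ioi_mem_nhds hs₀] with s hs
  exact (hopfSolution_of_pos u₀ hs x).symm

/-- For each `s₀ > 0`, `s ↦ u(s,x)` is continuous at `s₀` for a.e. `x` (all `x` off the countable
discontinuity set of the monotone function `y₊(s₀,·)`). [folklore] -/
theorem ae_continuousAt_hopfSolution_t (hm : Measurable u₀) (hM : ∀ x, |u₀ x| ≤ M) {s₀ : ℝ}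
    (hs₀ : 0 < s₀) : ∀ᵐ x : ℝ, ContinuousAt (fun s => hopfSolution u₀ s x) s₀ := by
  have hc : Set.Countable {x | ¬ContinuousAt (laxMinimizer u₀ s₀) x} :=
    (laxMinimizer_monotone hm hM hs₀).countable_not_continuousAt
  rw [ae_iff]
  refine measure_mono_null (fun x hx => ?_) (hc.measure_zero volume)
  exact fun hcont => hx (continuousAt_hopfSolution_t hm hM hs₀ hcont)

/-- **Weak continuity in time** (the regularity `u ∈ C⁰((0,∞); L¹_loc)` of Dafermos (6.2.7) in
the form needed downstream): for `φ` integrable on a set `S`, `s ↦ ∫_S φ(x) u(s,x) dx` is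
continuous on `(0, ∞)` (dominated convergence, `|u| ≤ M`). [cite: Dafermos2005, Thm 6.2.1 (6.2.7)] -/
theorem continuousOn_setIntegral_mul_hopfSolution (hm : Measurable u₀) (hM : ∀ x, |u₀ x| ≤ M)
    {φ : ℝ → ℝ} {S : Set ℝ} (hφ : IntegrableOn φ S) :
    ContinuousOn (fun s => ∫ x in S, φ x * hopfSolution u₀ s x) (Ioi 0) := by
  intro s₀ hs₀
  refine (continuousAt_of_dominated (bound := fun x => |φ x| * M) ?_ ?_ ?_ ?_).continuousWithinAt
  · exact Eventually.of_forall fun s =>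
      hφ.aestronglyMeasurable.mul (measurable_hopfSolution hm hM s).aestronglyMeasurable
  · refine Eventually.of_forall fun s => Eventually.of_forall fun x => ?_
    rw [Real.norm_eq_abs, abs_mul]
    exact mul_le_mul_of_nonneg_left (abs_hopfSolution_le hm hM s x) (abs_nonneg _)
  · exact hφ.abs.mul_const M
  · exact (ae_restrict_of_ae (ae_continuousAt_hopfSolution_t hm hM hs₀)).mono
      fun x hx => continuousAt_const.mul hx

/-! ### Test functions on `ℝ × ℝ` -/

section TestFunction

variable {ψ : ℝ × ℝ → ℝ}

/-- The time slice of a `C¹` function has derivative `Dψ(s,x)(1,0)`. [folklore] -/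
theorem hasDerivAt_testSlice_t (hψ : ContDiff ℝ 1 ψ) (s x : ℝ) :
    HasDerivAt (fun s' => ψ (s', x)) (fderiv ℝ ψ (s, x) (1, 0)) s := by
  have := ((hψ.differentiable one_ne_zero (s, x)).hasFDerivAt.comp s
    (hasFDerivAt_prodMk_left (𝕜 := ℝ) s x)).hasDerivAt
  simpa [Function.comp_def] using this

/-- The space slice of a `C¹` function has derivative `Dψ(s,x)(0,1)`. [folklore] -/
theorem hasDerivAt_testSlice_x (hψ : ContDiff ℝ 1 ψ) (s x : ℝ) :
    HasDerivAt (fun x' => ψ (s, x')) (fderiv ℝ ψ (s, x) (0, 1)) x := by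
  have := ((hψ.differentiable one_ne_zero (s, x)).hasFDerivAt.comp x
    (hasFDerivAt_prodMk_right (𝕜 := ℝ) s x)).hasDerivAt
  simpa [Function.comp_def] using this

/-- A compactly supported `C¹` function and its derivative vanish outside a square `[-R, R]²`.
[folklore] -/
theorem exists_radius_of_hasCompactSupport (hsupp : HasCompactSupport ψ) :
    ∃ R : ℝ, 0 < R ∧ ∀ p : ℝ × ℝ, (R < |p.1| ∨ R < |p.2|) → ψ p = 0 ∧ fderiv ℝ ψ p = 0 := by
  obtain ⟨R, hR⟩ := hsupp.isCompact.isBounded.subset_closedBall 0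
  refine ⟨max R 1, by positivity, fun p hp => ?_⟩
  have hnot : p ∉ tsupport ψ := by
    intro hmem
    have h := hR hmem
    rw [Metric.mem_closedBall, dist_zero_right, Prod.norm_def, Real.norm_eq_abs, Real.norm_eq_abs] at h
    rcases hp with hp | hp
    · linarith [le_max_left |p.1| |p.2|, le_max_left R 1]
    · linarith [le_max_right |p.1| |p.2|, le_max_left R 1]
  exact ⟨image_eq_zero_of_notMem_tsupport hnot,
    Function.notMem_support.1 fun h => hnot (support_fderiv_subset ℝ h)⟩

/-- A continuous function on `ℝ × ℝ` vanishing outside a square has compact support. [folklore] -/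
theorem hasCompactSupport_of_square {G : ℝ × ℝ → ℝ} {R : ℝ}
    (hG : ∀ p : ℝ × ℝ, (R < |p.1| ∨ R < |p.2|) → G p = 0) : HasCompactSupport G := by
  refine HasCompactSupport.intro ((isCompact_Icc (a := -R) (b := R)).prod
    (isCompact_Icc (a := -R) (b := R))) fun p hp => hG p ?_
  simp only [mem_prod, mem_Icc, not_and_or, not_le] at hp
  rcases hp with (hp | hp) | (hp | hp)
  · exact Or.inl (lt_of_lt_of_le (by linarith) (neg_le_abs _))
  · exact Or.inl (lt_of_lt_of_le hp (le_abs_self _))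
  · exact Or.inr (lt_of_lt_of_le (by linarith) (neg_le_abs _))
  · exact Or.inr (lt_of_lt_of_le hp (le_abs_self _))

/-- A continuous function on `ℝ` vanishing outside an interval `[-R, R]` has compact support.
[folklore] -/
theorem hasCompactSupport_of_interval {g : ℝ → ℝ} {R : ℝ} (hg : ∀ x : ℝ, R < |x| → g x = 0) :
    HasCompactSupport g := by
  refine HasCompactSupport.intro (isCompact_Icc (a := -R) (b := R)) fun x hx => hg x ?_
  simp only [mem_Icc, not_and_or, not_le] at hx
  rcases hx with hx | hx
  · exact lt_of_lt_of_le (by linarith) (neg_le_abs _)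
  · exact lt_of_lt_of_le hx (le_abs_self _)

end TestFunction

/-! ### Integration tools: dominated convergence on the half plane, integration by parts in `t` -/

/-- **Dominated convergence for iterated integrals over the half plane `t > 0`** with a uniform
bound and a uniform square support. [folklore] -/
theorem tendsto_integral_Ioi_integral {F : ℕ → ℝ × ℝ → ℝ} {G : ℝ × ℝ → ℝ} {R C : ℝ}
    (hF : ∀ n, Measurable (F n))
    (hsupp : ∀ n p, (R < |p.1| ∨ R < |p.2|) → F n p = 0) (hbdd : ∀ n p, |F n p| ≤ C)
    (hlim : ∀ p : ℝ × ℝ, 0 < p.1 → Tendsto (fun n => F n p) atTop (𝓝 (G p))) :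
    Tendsto (fun n => ∫ t in Ioi (0 : ℝ), ∫ x, F n (t, x)) atTop
      (𝓝 (∫ t in Ioi (0 : ℝ), ∫ x, G (t, x))) := by
  set μ : Measure (ℝ × ℝ) := ((volume : Measure ℝ).restrict (Ioi 0)).prod volume with hμ
  have hμ' : μ = (volume : Measure (ℝ × ℝ)).restrict (Ioi 0 ×ˢ univ) := by
    rw [hμ, Measure.restrict_prod_eq_prod_univ, Measure.volume_eq_prod]
  have hae : ∀ᵐ p ∂μ, 0 < p.1 := by
    rw [hμ']
    filter_upwards [ae_restrict_mem (measurableSet_Ioi.prod MeasurableSet.univ)] with p hp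
    exact hp.1
  -- the dominating function
  set B : Set (ℝ × ℝ) := Icc (-R) R ×ˢ Icc (-R) R with hB
  have hBm : MeasurableSet B := measurableSet_Icc.prod measurableSet_Icc
  have hBfin : (volume : Measure (ℝ × ℝ)) B < ⊤ := by
    rw [hB, Measure.volume_eq_prod, Measure.prod_prod]
    exact ENNReal.mul_lt_top measure_Icc_lt_top measure_Icc_lt_top
  set bound : ℝ × ℝ → ℝ := B.indicator fun _ => |C| with hbound
  have hbound_int : Integrable bound μ := by
    rw [hμ']
    exact ((integrable_indicator_iff hBm).2 (integrableOn_const hBfin.ne)).restrict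
  have hFle : ∀ n p, ‖F n p‖ ≤ bound p := by
    intro n p
    rw [Real.norm_eq_abs, hbound]
    by_cases hp : p ∈ B
    · rw [indicator_of_mem hp]
      exact (hbdd n p).trans (le_abs_self C)
    · rw [indicator_of_notMem hp]
      have : F n p = 0 := by
        refine hsupp n p ?_
        simp only [hB, mem_prod, mem_Icc, not_and_or, not_le] at hp
        rcases hp with (hp | hp) | (hp | hp)
        · exact Or.inl (lt_of_lt_of_le (by linarith) (neg_le_abs _))
        · exact Or.inl (lt_of_lt_of_le hp (le_abs_self _))
        · exact Or.inr (lt_of_lt_of_le (by linarith) (neg_le_abs _))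
        · exact Or.inr (lt_of_lt_of_le hp (le_abs_self _))
      simp [this]
  have hFint : ∀ n, Integrable (F n) μ := fun n =>
    hbound_int.mono' (hF n).aestronglyMeasurable (Eventually.of_forall (hFle n))
  have hlim' : ∀ᵐ p ∂μ, Tendsto (fun n => F n p) atTop (𝓝 (G p)) :=
    hae.mono fun p hp => hlim p hp
  have hGm : AEStronglyMeasurable G μ :=
    aestronglyMeasurable_of_tendsto_ae atTop (fun n => (hF n).aestronglyMeasurable) hlim'
  have hGle : ∀ᵐ p ∂μ, ‖G p‖ ≤ bound p :=
    hlim'.mono fun p hp => le_of_tendsto hp.norm (Eventually.of_forall fun n => hFle n p)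
  have hGint : Integrable G μ := hbound_int.mono' hGm hGle
  have key := tendsto_integral_of_dominated_convergence bound
    (fun n => (hF n).aestronglyMeasurable) hbound_int (fun n => Eventually.of_forall (hFle n)) hlim'
  rw [integral_prod G hGint] at key
  refine key.congr fun n => ?_
  rw [integral_prod _ (hFint n)]

/-- **Integration by parts on the half line** for a Lipschitz `f` (absolutely continuous, so the
fundamental theorem of calculus holds with the a.e. derivative) against a `C¹` function `g`
vanishing for `t > T`: `∫₀^∞ f g′ = -f(0) g(0) - ∫₀^∞ f′ g`. [folklore] -/
theorem integral_Ioi_mul_deriv_eq_of_lipschitz {f g : ℝ → ℝ} {K : NNReal} {T : ℝ} (hT : 0 < T)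
    (hf : LipschitzWith K f) (hg : ContDiff ℝ 1 g) (hgT : ∀ t, T < t → g t = 0) :
    ∫ t in Ioi (0 : ℝ), f t * deriv g t = -(f 0 * g 0) - ∫ t in Ioi (0 : ℝ), deriv f t * g t := by
  have hg' : ∀ t, T < t → deriv g t = 0 := by
    intro t ht
    have h : g =ᶠ[𝓝 t] fun _ => 0 := by
      filter_upwards [Ioi_mem_nhds ht] with s hs using hgT s hs
    rw [h.deriv_eq, deriv_const]
  have hT1 : (0 : ℝ) ≤ T + 1 := by linarith
  have restr : ∀ F : ℝ → ℝ, (∀ t, T < t → F t = 0) →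
      ∫ t in Ioi (0 : ℝ), F t = ∫ t in (0 : ℝ)..(T + 1), F t := by
    intro F hF
    rw [intervalIntegral.integral_of_le hT1]
    refine setIntegral_eq_of_subset_of_forall_sdiff_eq_zero measurableSet_Ioi
      Ioc_subset_Ioi_self fun t ht => hF t ?_
    simp only [Set.mem_sdiff, mem_Ioi, mem_Ioc, not_and, not_le] at ht
    linarith [ht.2 ht.1]
  rw [restr (fun t => f t * deriv g t) (fun t ht => by simp [hg' t ht]),
    restr (fun t => deriv f t * g t) (fun t ht => by simp [hgT t ht])]
  have hfAC : AbsolutelyContinuousOnInterval f 0 (T + 1) :=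
    (hf.lipschitzOnWith (s := uIcc 0 (T + 1))).absolutelyContinuousOnInterval
  have hgAC : AbsolutelyContinuousOnInterval g 0 (T + 1) :=
    hg.contDiffOn.absolutelyContinuousOnInterval
  rw [hfAC.integral_mul_deriv_eq_deriv_mul hgAC, hgT (T + 1) (by linarith)]
  ring

/-! ### The weak form of the Cauchy problem for Hopf's solution -/

section WeakForm

variable {ψ : ℝ × ℝ → ℝ}

/-- Continuous functions on the half plane with square support are integrable for the product
of Lebesgue measure on `(0,∞)` with Lebesgue measure. [folklore] -/
theorem integrable_prod_Ioi_of_continuous {G : ℝ × ℝ → ℝ} {R : ℝ} (hG : Continuous G)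
    (hGs : ∀ p : ℝ × ℝ, (R < |p.1| ∨ R < |p.2|) → G p = 0) :
    Integrable G (((volume : Measure ℝ).restrict (Ioi 0)).prod volume) := by
  have h : Integrable G (volume : Measure (ℝ × ℝ)) :=
    hG.integrable_of_hasCompactSupport (hasCompactSupport_of_square hGs)
  rw [Measure.restrict_prod_eq_prod_univ, ← Measure.volume_eq_prod]
  exact h.restrict

/-- A bounded measurable function times a continuous function with square support is
integrable on the half plane. [folklore] -/
theorem integrable_prod_Ioi_of_bdd_mul {v G : ℝ × ℝ → ℝ} {R C : ℝ} (hv : Measurable v)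
    (hvC : ∀ p, |v p| ≤ C) (hG : Continuous G)
    (hGs : ∀ p : ℝ × ℝ, (R < |p.1| ∨ R < |p.2|) → G p = 0) :
    Integrable (fun p => v p * G p) (((volume : Measure ℝ).restrict (Ioi 0)).prod volume) :=
  (integrable_prod_Ioi_of_continuous hG hGs).bdd_mul hv.aestronglyMeasurable
    (Eventually.of_forall fun p => by simpa [Real.norm_eq_abs] using hvC p)

/-- Backward difference quotients of a differentiable function along `h = 1/(n+1)`:
`(f(x - h) - f(x))/h → -f′(x)`. [folklore] -/
theorem tendsto_backward_quotient {f : ℝ → ℝ} {f' x : ℝ} (hf : HasDerivAt f f' x) :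
    Tendsto (fun n : ℕ => (f (x - 1 / ((n : ℝ) + 1)) - f x) / (1 / ((n : ℝ) + 1))) atTop
      (𝓝 (-f')) := by
  rw [hasDerivAt_iff_tendsto_slope_zero] at hf
  have hneg : Tendsto (fun n : ℕ => -(1 / ((n : ℝ) + 1))) atTop (𝓝[≠] 0) := by
    refine tendsto_nhdsWithin_iff.2 ⟨?_, Eventually.of_forall fun n => ?_⟩
    · have h := (tendsto_one_div_add_atTop_nhds_zero_nat (𝕜 := ℝ)).neg
      rw [neg_zero] at h
      exact h
    · have : (0 : ℝ) < 1 / ((n : ℝ) + 1) := by positivity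
      exact ne_of_lt (by linarith)
  have h := (hf.comp hneg).neg
  refine h.congr fun n => ?_
  simp only [Function.comp_apply, smul_eq_mul]
  have hn : (1 : ℝ) / ((n : ℝ) + 1) ≠ 0 := by positivity
  field_simp
  ring_nf

/-- **The `x`-difference quotient identity.** For `h > 0` and a `C¹` compactly supported test
function `ψ`, moving the difference quotient from `W` onto `∂ₜψ` (translation invariance),
swapping the integrals (Fubini) and integrating by parts in `t` (the Lipschitz function
`t ↦ W(t,x)` is absolutely continuous with a.e. derivative `-u²/2`) gives
`∬_{t>0} D_h W · ∂ₜψ = -∫ U₀(x) Φ_h(0,x) dx + ∬_{t>0} (u²/2) Φ_h`,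
`Φ_h(t,x) = (ψ(t,x-h) - ψ(t,x))/h`. [folklore] -/
theorem integral_slope_hopfLaxPotential_mul_eq (hm : Measurable u₀) (hM : ∀ x, |u₀ x| ≤ M)
    (hψ : ContDiff ℝ 1 ψ) (hsupp : HasCompactSupport ψ) {h : ℝ} (hh : 0 < h) :
    ∫ t in Ioi (0 : ℝ), ∫ x, (hopfLaxPotential u₀ t (x + h) - hopfLaxPotential u₀ t x) / h
        * fderiv ℝ ψ (t, x) (1, 0)
      = -(∫ x, burgersPrimitive u₀ x * ((ψ (0, x - h) - ψ (0, x)) / h))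
        + ∫ t in Ioi (0 : ℝ), ∫ x,
            hopfSolution u₀ t x ^ 2 / 2 * ((ψ (t, x - h) - ψ (t, x)) / h) := by
  obtain ⟨R, hR0, hR⟩ := exists_radius_of_hasCompactSupport hsupp
  -- notation and basic facts
  set W := hopfLaxPotential u₀ with hW
  set Φ : ℝ × ℝ → ℝ := fun p => (ψ (p.1, p.2 - h) - ψ p) / h with hΦ
  set Θ : ℝ × ℝ → ℝ := fun p => (fderiv ℝ ψ (p.1, p.2 - h) (1, 0) - fderiv ℝ ψ p (1, 0)) / h
    with hΘ
  have hWc : Continuous (Function.uncurry W) := continuous_uncurry_hopfLaxPotential hm hM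
  have hψtc : Continuous fun p : ℝ × ℝ => fderiv ℝ ψ p (1, 0) :=
    (hψ.continuous_fderiv one_ne_zero).clm_apply continuous_const
  have hshift : Continuous fun p : ℝ × ℝ => (p.1, p.2 - h) := by fun_prop
  have hΦc : Continuous Φ := ((hψ.continuous.comp hshift).sub hψ.continuous).div_const h
  have hΘc : Continuous Θ := ((hψtc.comp hshift).sub hψtc).div_const h
  have hψt0 : ∀ p : ℝ × ℝ, (R < |p.1| ∨ R < |p.2|) → fderiv ℝ ψ p (1, 0) = 0 := fun p hp => by
    simp [(hR p hp).2]
  have hψ0 : ∀ p : ℝ × ℝ, (R < |p.1| ∨ R < |p.2|) → ψ p = 0 := fun p hp => (hR p hp).1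
  -- supports: everything vanishes outside the square of size `R + h`
  have hbig : ∀ p : ℝ × ℝ, (R + h < |p.1| ∨ R + h < |p.2|) →
      (R < |p.1| ∨ R < |p.2|) ∧ (R < |(p.1, p.2 - h).1| ∨ R < |(p.1, p.2 - h).2|) := by
    intro p hp
    rcases hp with hp | hp
    · exact ⟨Or.inl (by linarith), Or.inl (by simpa using (by linarith : R < |p.1|))⟩
    · refine ⟨Or.inr (by linarith), Or.inr ?_⟩
      simp only
      have := abs_sub_abs_le_abs_sub p.2 h
      rw [abs_of_pos hh] at this
      linarith
  have hΦ0 : ∀ p : ℝ × ℝ, (R + h < |p.1| ∨ R + h < |p.2|) → Φ p = 0 := fun p hp => by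
    simp only [hΦ, hψ0 p (hbig p hp).1, hψ0 _ (hbig p hp).2, sub_self, zero_div]
  have hΘ0 : ∀ p : ℝ × ℝ, (R + h < |p.1| ∨ R + h < |p.2|) → Θ p = 0 := fun p hp => by
    simp only [hΘ, hψt0 p (hbig p hp).1, hψt0 _ (hbig p hp).2, sub_self, zero_div]
  have hΦ0t : ∀ t x, R < |t| → Φ (t, x) = 0 := fun t x ht => by
    simp only [hΦ, hψ0 (t, x) (Or.inl ht), hψ0 (t, x - h) (Or.inl ht), sub_self, zero_div]
  -- Step 1: the difference quotient moves onto the test function (translation invariance)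
  have step1 : ∀ t, ∫ x, (W t (x + h) - W t x) / h * fderiv ℝ ψ (t, x) (1, 0)
      = ∫ x, W t x * Θ (t, x) := by
    intro t
    have hWt : Continuous (W t) := hWc.comp (continuous_const.prodMk continuous_id)
    have hWth : Continuous fun x => W t (x + h) :=
      hWc.comp (continuous_const.prodMk (continuous_id.add continuous_const))
    have hst : Continuous fun x => fderiv ℝ ψ (t, x) (1, 0) :=
      hψtc.comp (continuous_const.prodMk continuous_id)
    have hsth : Continuous fun x => fderiv ℝ ψ (t, x - h) (1, 0) :=
      hψtc.comp (continuous_const.prodMk (continuous_id.sub continuous_const))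
    have hcs : HasCompactSupport fun x => fderiv ℝ ψ (t, x) (1, 0) :=
      hasCompactSupport_of_interval fun x hx => hψt0 (t, x) (Or.inr hx)
    have hcsh : HasCompactSupport fun x => fderiv ℝ ψ (t, x - h) (1, 0) := by
      refine hasCompactSupport_of_interval (R := R + h) fun x hx => hψt0 (t, x - h) (Or.inr ?_)
      have := abs_sub_abs_le_abs_sub x h
      rw [abs_of_pos hh] at this
      simp only
      linarith
    have i1 : Integrable fun x => W t (x + h) * fderiv ℝ ψ (t, x) (1, 0) :=
      (hWth.mul hst).integrable_of_hasCompactSupport hcs.mul_left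
    have i2 : Integrable fun x => W t x * fderiv ℝ ψ (t, x) (1, 0) :=
      (hWt.mul hst).integrable_of_hasCompactSupport hcs.mul_left
    have i3 : Integrable fun x => W t x * fderiv ℝ ψ (t, x - h) (1, 0) :=
      (hWt.mul hsth).integrable_of_hasCompactSupport hcsh.mul_left
    have htrans : ∫ x, W t (x + h) * fderiv ℝ ψ (t, x) (1, 0)
        = ∫ x, W t x * fderiv ℝ ψ (t, x - h) (1, 0) := by
      have := integral_add_right_eq_self (μ := (volume : Measure ℝ))
        (fun x => W t x * fderiv ℝ ψ (t, x - h) (1, 0)) h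
      simpa using this
    have e1 : (fun x => (W t (x + h) - W t x) / h * fderiv ℝ ψ (t, x) (1, 0))
        = fun x => h⁻¹ * (W t (x + h) * fderiv ℝ ψ (t, x) (1, 0)
          - W t x * fderiv ℝ ψ (t, x) (1, 0)) := by
      funext x
      field_simp
    have e2 : (fun x => W t x * Θ (t, x))
        = fun x => h⁻¹ * (W t x * fderiv ℝ ψ (t, x - h) (1, 0)
          - W t x * fderiv ℝ ψ (t, x) (1, 0)) := by
      funext x
      simp only [hΘ]
      field_simp
    rw [e1, e2, MeasureTheory.integral_const_mul, MeasureTheory.integral_const_mul,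
      integral_sub i1 i2, integral_sub i3 i2, htrans]
  -- Step 2: Fubini
  have hI1 : Integrable (fun p : ℝ × ℝ => Function.uncurry W p * Θ p)
      (((volume : Measure ℝ).restrict (Ioi 0)).prod volume) :=
    integrable_prod_Ioi_of_continuous (R := R + h) (hWc.mul hΘc) fun p hp => by simp [hΘ0 p hp]
  have step2 : ∫ t in Ioi (0 : ℝ), ∫ x, W t x * Θ (t, x) = ∫ x, ∫ t in Ioi (0 : ℝ), W t x * Θ (t, x) :=
    integral_integral_swap hI1
  -- Step 3: integration by parts in `t` for each `x`
  have step3 : ∀ x, ∫ t in Ioi (0 : ℝ), W t x * Θ (t, x)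
      = -(burgersPrimitive u₀ x * Φ (0, x))
        + ∫ t in Ioi (0 : ℝ), hopfSolution u₀ t x ^ 2 / 2 * Φ (t, x) := by
    intro x
    have hg : ContDiff ℝ 1 fun t => Φ (t, x) := by
      simp only [hΦ]
      exact ((hψ.comp (contDiff_id.prodMk contDiff_const)).sub
        (hψ.comp (contDiff_id.prodMk contDiff_const))).div_const _
    have hderiv : ∀ t, deriv (fun t => Φ (t, x)) t = Θ (t, x) := by
      intro t
      simp only [hΦ, hΘ]
      exact (((hasDerivAt_testSlice_t hψ t (x - h)).sub
        (hasDerivAt_testSlice_t hψ t x)).div_const h).deriv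
    have hparts := integral_Ioi_mul_deriv_eq_of_lipschitz hR0
      (lipschitzWith_hopfLaxPotential_t hm hM x) hg (fun t ht => hΦ0t t x (by
        rw [abs_of_pos (hR0.trans ht)]; exact ht))
    simp_rw [hderiv] at hparts
    rw [hparts, hopfLaxPotential_of_nonpos u₀ le_rfl x]
    -- replace the a.e. derivative by `-u²/2`
    have hAC : AbsolutelyContinuousOnInterval (fun t => hopfLaxPotential u₀ t x) 0 (R + 1) :=
      ((lipschitzWith_hopfLaxPotential_t hm hM x).lipschitzOnWith
        (s := uIcc 0 (R + 1))).absolutelyContinuousOnInterval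
    have hae : ∀ᵐ t ∂(volume.restrict (Ioi (0 : ℝ))),
        deriv (fun t => hopfLaxPotential u₀ t x) t * Φ (t, x)
          = -(hopfSolution u₀ t x ^ 2 / 2 * Φ (t, x)) := by
      rw [ae_restrict_iff' measurableSet_Ioi]
      filter_upwards [hAC.ae_differentiableAt] with t ht h0
      by_cases htR : t ≤ R + 1
      · have hdiff := ht (by
          rw [uIcc_of_le (by linarith : (0 : ℝ) ≤ R + 1)]
          exact ⟨le_of_lt h0, htR⟩)
        rw [hasDerivAt_hopfLaxPotential_t_unique hm hM h0 hdiff.hasDerivAt]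
        ring
      · have : Φ (t, x) = 0 := hΦ0t t x (by rw [abs_of_pos h0]; linarith)
        simp [this]
    rw [integral_congr_ae hae, MeasureTheory.integral_neg]
    ring
  -- Step 4: assemble, swap back
  have hu2m : Measurable fun p : ℝ × ℝ => hopfSolution u₀ p.1 p.2 ^ 2 / 2 :=
    ((measurable_uncurry_hopfSolution hm hM).pow_const 2).div_const 2
  have hu2b : ∀ p : ℝ × ℝ, |hopfSolution u₀ p.1 p.2 ^ 2 / 2| ≤ M ^ 2 / 2 := by
    intro p
    rw [abs_div, abs_of_pos (by norm_num : (0 : ℝ) < 2), abs_pow]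
    have := abs_hopfSolution_le hm hM p.1 p.2
    have h0 : 0 ≤ |hopfSolution u₀ p.1 p.2| := abs_nonneg _
    nlinarith
  have hI2 : Integrable (fun p : ℝ × ℝ => hopfSolution u₀ p.1 p.2 ^ 2 / 2 * Φ p)
      (((volume : Measure ℝ).restrict (Ioi 0)).prod volume) :=
    integrable_prod_Ioi_of_bdd_mul hu2m hu2b hΦc hΦ0
  have hI2' := hI2.swap
  have step4 : ∫ x, ∫ t in Ioi (0 : ℝ), hopfSolution u₀ t x ^ 2 / 2 * Φ (t, x)
      = ∫ t in Ioi (0 : ℝ), ∫ x, hopfSolution u₀ t x ^ 2 / 2 * Φ (t, x) :=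
    integral_integral_swap hI2'
  have hA : Integrable fun x => burgersPrimitive u₀ x * Φ (0, x) := by
    refine ((continuous_burgersPrimitive hm hM).mul
      (hΦc.comp (continuous_const.prodMk continuous_id))).integrable_of_hasCompactSupport ?_
    exact (hasCompactSupport_of_interval (R := R + h) fun x hx => hΦ0 (0, x) (Or.inr hx)).mul_left
  have hA' : Integrable fun x => -(burgersPrimitive u₀ x * Φ (0, x)) := hA.neg
  have hB : Integrable fun x => ∫ t in Ioi (0 : ℝ), hopfSolution u₀ t x ^ 2 / 2 * Φ (t, x) :=
    hI2'.integral_prod_left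
  calc ∫ t in Ioi (0 : ℝ), ∫ x, (W t (x + h) - W t x) / h * fderiv ℝ ψ (t, x) (1, 0)
      = ∫ t in Ioi (0 : ℝ), ∫ x, W t x * Θ (t, x) := by
        exact congrArg (integral _) (funext step1)
    _ = ∫ x, ∫ t in Ioi (0 : ℝ), W t x * Θ (t, x) := step2
    _ = ∫ x, (-(burgersPrimitive u₀ x * Φ (0, x))
          + ∫ t in Ioi (0 : ℝ), hopfSolution u₀ t x ^ 2 / 2 * Φ (t, x)) :=
        congrArg (integral _) (funext step3)
    _ = -(∫ x, burgersPrimitive u₀ x * Φ (0, x))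
          + ∫ x, ∫ t in Ioi (0 : ℝ), hopfSolution u₀ t x ^ 2 / 2 * Φ (t, x) := by
        rw [integral_add hA' hB, MeasureTheory.integral_neg]
    _ = _ := by rw [step4]

/-- **Limit of the left-hand side**: `∬_{t>0} D_h W ∂ₜψ → ∬_{t>0} u ∂ₜψ` as `h = 1/(n+1) → 0`
(dominated convergence: `D_hW → u` pointwise on `t > 0`, `|D_hW| ≤ M`). [folklore] -/
theorem tendsto_integral_slope_hopfLaxPotential_mul (hm : Measurable u₀) (hM : ∀ x, |u₀ x| ≤ M)
    (hψ : ContDiff ℝ 1 ψ) (hsupp : HasCompactSupport ψ) :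
    Tendsto (fun n : ℕ => ∫ t in Ioi (0 : ℝ), ∫ x,
        (hopfLaxPotential u₀ t (x + 1 / ((n : ℝ) + 1)) - hopfLaxPotential u₀ t x)
          / (1 / ((n : ℝ) + 1)) * fderiv ℝ ψ (t, x) (1, 0)) atTop
      (𝓝 (∫ t in Ioi (0 : ℝ), ∫ x, hopfSolution u₀ t x * fderiv ℝ ψ (t, x) (1, 0))) := by
  obtain ⟨R, hR0, hR⟩ := exists_radius_of_hasCompactSupport hsupp
  have hψtc : Continuous fun p : ℝ × ℝ => fderiv ℝ ψ p (1, 0) :=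
    (hψ.continuous_fderiv one_ne_zero).clm_apply continuous_const
  have hψt0 : ∀ p : ℝ × ℝ, (R < |p.1| ∨ R < |p.2|) → fderiv ℝ ψ p (1, 0) = 0 := fun p hp => by
    simp [(hR p hp).2]
  obtain ⟨S, hS⟩ := hψtc.bounded_above_of_compact_support (hasCompactSupport_of_square hψt0)
  have hWc : Continuous (Function.uncurry (hopfLaxPotential u₀)) :=
    continuous_uncurry_hopfLaxPotential hm hM
  refine tendsto_integral_Ioi_integral (R := R) (C := M * S)
    (F := fun n p => (hopfLaxPotential u₀ p.1 (p.2 + 1 / ((n : ℝ) + 1))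
      - hopfLaxPotential u₀ p.1 p.2) / (1 / ((n : ℝ) + 1)) * fderiv ℝ ψ p (1, 0))
    (G := fun p => hopfSolution u₀ p.1 p.2 * fderiv ℝ ψ p (1, 0)) ?_ ?_ ?_ ?_
  · intro n
    refine Continuous.measurable ?_
    have h1 : Continuous fun p : ℝ × ℝ => hopfLaxPotential u₀ p.1 (p.2 + 1 / ((n : ℝ) + 1)) :=
      hWc.comp (continuous_fst.prodMk (continuous_snd.add continuous_const))
    exact ((h1.sub hWc).div_const _).mul hψtc
  · intro n p hp
    simp [hψt0 p hp]
  · intro n p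
    have hq : |(hopfLaxPotential u₀ p.1 (p.2 + 1 / ((n : ℝ) + 1)) - hopfLaxPotential u₀ p.1 p.2)
        / (1 / ((n : ℝ) + 1))| ≤ M := by
      have hpos : (0 : ℝ) < 1 / ((n : ℝ) + 1) := by positivity
      rw [abs_div, abs_of_pos hpos, div_le_iff₀ hpos]
      have := abs_hopfLaxPotential_sub_le_x hm hM p.1 p.2 (p.2 + 1 / ((n : ℝ) + 1))
      rwa [show p.2 + 1 / ((n : ℝ) + 1) - p.2 = 1 / ((n : ℝ) + 1) by ring, abs_of_pos hpos] at this
    rw [abs_mul]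
    have hS' := hS p
    rw [Real.norm_eq_abs] at hS'
    exact mul_le_mul hq hS' (abs_nonneg _) (nonneg_of_abs_le hM)
  · intro p hp
    exact ((tendsto_slope_hopfLaxPotential_x hm hM hp p.2).comp
      tendsto_one_div_add_one_nhdsGT).mul_const _

/-- **Limit of the initial layer term**: `∫ U₀(x) Φ_h(0,x) dx → -∫ U₀(x) ∂ₓψ(0,x) dx`.
[folklore] -/
theorem tendsto_integral_burgersPrimitive_mul_quotient (hm : Measurable u₀) (hM : ∀ x, |u₀ x| ≤ M)
    (hψ : ContDiff ℝ 1 ψ) (hsupp : HasCompactSupport ψ) :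
    Tendsto (fun n : ℕ => ∫ x, burgersPrimitive u₀ x
        * ((ψ (0, x - 1 / ((n : ℝ) + 1)) - ψ (0, x)) / (1 / ((n : ℝ) + 1)))) atTop
      (𝓝 (∫ x, burgersPrimitive u₀ x * -fderiv ℝ ψ (0, x) (0, 1))) := by
  obtain ⟨R, hR0, hR⟩ := exists_radius_of_hasCompactSupport hsupp
  obtain ⟨K, hK⟩ := ContDiff.lipschitzWith_of_hasCompactSupport hsupp hψ (by simp)
  have hψ0 : ∀ p : ℝ × ℝ, (R < |p.1| ∨ R < |p.2|) → ψ p = 0 := fun p hp => (hR p hp).1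
  have hUc := continuous_burgersPrimitive hm hM
  -- dominating function: `K |U₀| 𝟙_{[-(R+1), R+1]}`
  set B : Set ℝ := Icc (-(R + 1)) (R + 1) with hB
  have hbound : Integrable (B.indicator fun x => (K : ℝ) * |burgersPrimitive u₀ x|) := by
    rw [integrable_indicator_iff measurableSet_Icc]
    exact (continuous_const.mul hUc.abs).continuousOn.integrableOn_Icc
  refine tendsto_integral_of_dominated_convergence
    (B.indicator fun x => (K : ℝ) * |burgersPrimitive u₀ x|) ?_ hbound ?_ ?_
  · intro n
    refine (hUc.mul ?_).aestronglyMeasurable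
    exact (((hψ.continuous.comp (by fun_prop : Continuous fun x : ℝ => ((0 : ℝ), x - 1 / ((n : ℝ) + 1)))).sub
      (hψ.continuous.comp (by fun_prop : Continuous fun x : ℝ => ((0 : ℝ), x)))).div_const _)
  · intro n
    refine Eventually.of_forall fun x => ?_
    have hpos : (0 : ℝ) < 1 / ((n : ℝ) + 1) := by positivity
    have hle1 : 1 / ((n : ℝ) + 1) ≤ 1 := by
      rw [div_le_one (by positivity)]
      linarith [n.cast_nonneg (α := ℝ)]
    have hquot : |(ψ (0, x - 1 / ((n : ℝ) + 1)) - ψ (0, x)) / (1 / ((n : ℝ) + 1))| ≤ K := by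
      rw [abs_div, abs_of_pos hpos, div_le_iff₀ hpos]
      have h := hK.dist_le_mul (0, x - 1 / ((n : ℝ) + 1)) (0, x)
      rw [Real.dist_eq, Prod.dist_eq, Real.dist_eq, Real.dist_eq, sub_self, abs_zero,
        show x - 1 / ((n : ℝ) + 1) - x = -(1 / ((n : ℝ) + 1)) by ring, abs_neg, abs_of_pos hpos,
        max_eq_right hpos.le] at h
      exact h
    rw [Real.norm_eq_abs, abs_mul]
    by_cases hx : x ∈ B
    · rw [indicator_of_mem hx, mul_comm]
      exact mul_le_mul_of_nonneg_right hquot (abs_nonneg _)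
    · rw [indicator_of_notMem hx]
      have hx' : R + 1 < |x| := by
        simp only [hB, mem_Icc, not_and_or, not_le] at hx
        rcases hx with hx | hx
        · exact lt_of_lt_of_le (by linarith) (neg_le_abs _)
        · exact lt_of_lt_of_le hx (le_abs_self _)
      have h1 : ψ (0, x) = 0 := hψ0 (0, x) (Or.inr (by simp only; linarith))
      have h2 : ψ (0, x - 1 / ((n : ℝ) + 1)) = 0 := by
        refine hψ0 _ (Or.inr ?_)
        simp only
        have := abs_sub_abs_le_abs_sub x (1 / ((n : ℝ) + 1))
        rw [abs_of_pos hpos] at this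
        linarith
      rw [h1, h2, sub_self, zero_div, abs_zero, mul_zero]
  · refine Eventually.of_forall fun x => ?_
    exact (tendsto_backward_quotient (hasDerivAt_testSlice_x hψ 0 x)).const_mul _

/-- **Limit of the quadratic term**: `∬_{t>0} (u²/2) Φ_h → -∬_{t>0} (u²/2) ∂ₓψ`. [folklore] -/
theorem tendsto_integral_sq_mul_quotient (hm : Measurable u₀) (hM : ∀ x, |u₀ x| ≤ M)
    (hψ : ContDiff ℝ 1 ψ) (hsupp : HasCompactSupport ψ) :
    Tendsto (fun n : ℕ => ∫ t in Ioi (0 : ℝ), ∫ x, hopfSolution u₀ t x ^ 2 / 2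
        * ((ψ (t, x - 1 / ((n : ℝ) + 1)) - ψ (t, x)) / (1 / ((n : ℝ) + 1)))) atTop
      (𝓝 (∫ t in Ioi (0 : ℝ), ∫ x,
        hopfSolution u₀ t x ^ 2 / 2 * -fderiv ℝ ψ (t, x) (0, 1))) := by
  obtain ⟨R, hR0, hR⟩ := exists_radius_of_hasCompactSupport hsupp
  obtain ⟨K, hK⟩ := ContDiff.lipschitzWith_of_hasCompactSupport hsupp hψ (by simp)
  have hψ0 : ∀ p : ℝ × ℝ, (R < |p.1| ∨ R < |p.2|) → ψ p = 0 := fun p hp => (hR p hp).1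
  have hu2m : Measurable fun p : ℝ × ℝ => hopfSolution u₀ p.1 p.2 ^ 2 / 2 :=
    ((measurable_uncurry_hopfSolution hm hM).pow_const 2).div_const 2
  refine tendsto_integral_Ioi_integral (R := R + 1) (C := M ^ 2 / 2 * K)
    (F := fun n p => hopfSolution u₀ p.1 p.2 ^ 2 / 2
      * ((ψ (p.1, p.2 - 1 / ((n : ℝ) + 1)) - ψ p) / (1 / ((n : ℝ) + 1))))
    (G := fun p => hopfSolution u₀ p.1 p.2 ^ 2 / 2 * -fderiv ℝ ψ p (0, 1)) ?_ ?_ ?_ ?_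
  · intro n
    refine hu2m.mul (Continuous.measurable ?_)
    exact ((hψ.continuous.comp (by fun_prop)).sub hψ.continuous).div_const _
  · intro n p hp
    have hpos : (0 : ℝ) < 1 / ((n : ℝ) + 1) := by positivity
    have h1 : ψ p = 0 := hψ0 p (by rcases hp with hp | hp <;> [left; right] <;> linarith)
    have h2 : ψ (p.1, p.2 - 1 / ((n : ℝ) + 1)) = 0 := by
      refine hψ0 _ ?_
      rcases hp with hp | hp
      · exact Or.inl (by simp only; linarith)
      · right
        simp only
        have hle1 : 1 / ((n : ℝ) + 1) ≤ 1 := by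
          rw [div_le_one (by positivity)]
          linarith [n.cast_nonneg (α := ℝ)]
        have := abs_sub_abs_le_abs_sub p.2 (1 / ((n : ℝ) + 1))
        rw [abs_of_pos hpos] at this
        linarith
    rw [h1, h2, sub_self, zero_div, mul_zero]
  · intro n p
    have hpos : (0 : ℝ) < 1 / ((n : ℝ) + 1) := by positivity
    have hquot : |(ψ (p.1, p.2 - 1 / ((n : ℝ) + 1)) - ψ p) / (1 / ((n : ℝ) + 1))| ≤ K := by
      rw [abs_div, abs_of_pos hpos, div_le_iff₀ hpos]
      have h := hK.dist_le_mul (p.1, p.2 - 1 / ((n : ℝ) + 1)) p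
      rw [Real.dist_eq, Prod.dist_eq, Real.dist_eq, Real.dist_eq, sub_self, abs_zero,
        show p.2 - 1 / ((n : ℝ) + 1) - p.2 = -(1 / ((n : ℝ) + 1)) by ring, abs_neg, abs_of_pos hpos,
        max_eq_right hpos.le] at h
      exact h
    have hsq : |hopfSolution u₀ p.1 p.2 ^ 2 / 2| ≤ M ^ 2 / 2 := by
      rw [abs_div, abs_of_pos (by norm_num : (0 : ℝ) < 2), abs_pow]
      have := abs_hopfSolution_le hm hM p.1 p.2
      have h0 : 0 ≤ |hopfSolution u₀ p.1 p.2| := abs_nonneg _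
      nlinarith
    rw [abs_mul]
    exact mul_le_mul hsq hquot (abs_nonneg _) (by positivity)
  · intro p _
    exact (tendsto_backward_quotient (hasDerivAt_testSlice_x hψ p.1 p.2)).const_mul _

/-- **The initial layer**: `∫ U₀(x) ∂ₓψ(0,x) dx = -∫ u₀(x) ψ(0,x) dx` (integration by parts for
the absolutely continuous `U₀`, whose a.e. derivative is `u₀` by Lebesgue's differentiation
theorem). [folklore] -/
theorem integral_burgersPrimitive_mul_deriv (hm : Measurable u₀) (hM : ∀ x, |u₀ x| ≤ M)
    (hψ : ContDiff ℝ 1 ψ) (hsupp : HasCompactSupport ψ) :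
    ∫ x, burgersPrimitive u₀ x * fderiv ℝ ψ (0, x) (0, 1) = -∫ x, u₀ x * ψ (0, x) := by
  obtain ⟨R, hR0, hR⟩ := exists_radius_of_hasCompactSupport hsupp
  have hψ0 : ∀ x : ℝ, R < |x| → ψ (0, x) = 0 := fun x hx => (hR (0, x) (Or.inr hx)).1
  have hψx0 : ∀ x : ℝ, R < |x| → fderiv ℝ ψ (0, x) (0, 1) = 0 := fun x hx => by
    simp [(hR (0, x) (Or.inr hx)).2]
  have hgd : ∀ x, deriv (fun x' => ψ (0, x')) x = fderiv ℝ ψ (0, x) (0, 1) := fun x =>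
    (hasDerivAt_testSlice_x hψ 0 x).deriv
  have hgC : ContDiff ℝ 1 fun x' : ℝ => ψ (0, x') :=
    hψ.comp (ContDiff.prodMk contDiff_const contDiff_id)
  have hab : -(R + 1) ≤ R + 1 := by linarith
  have hout : ∀ x, x ∉ Ioc (-(R + 1)) (R + 1) → R < |x| := by
    intro x hx
    simp only [mem_Ioc, not_and_or, not_lt, not_le] at hx
    rcases hx with hx | hx
    · exact lt_of_lt_of_le (by linarith) (neg_le_abs _)
    · exact lt_of_lt_of_le (by linarith) (le_abs_self _)
  -- both sides are interval integrals over `[-(R+1), R+1]`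
  have e1 : ∫ x, burgersPrimitive u₀ x * fderiv ℝ ψ (0, x) (0, 1)
      = ∫ x in (-(R + 1))..(R + 1), burgersPrimitive u₀ x * deriv (fun x' => ψ (0, x')) x := by
    rw [intervalIntegral.integral_of_le hab, setIntegral_eq_integral_of_forall_compl_eq_zero]
    · simp_rw [hgd]
    · intro x hx
      rw [hgd, hψx0 x (hout x hx), mul_zero]
  have e2 : ∫ x, u₀ x * ψ (0, x) = ∫ x in (-(R + 1))..(R + 1), u₀ x * ψ (0, x) := by
    rw [intervalIntegral.integral_of_le hab, setIntegral_eq_integral_of_forall_compl_eq_zero]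
    intro x hx
    rw [hψ0 x (hout x hx), mul_zero]
  have hUAC : AbsolutelyContinuousOnInterval (burgersPrimitive u₀) (-(R + 1)) (R + 1) :=
    ((lipschitzWith_burgersPrimitive hm hM).lipschitzOnWith
      (s := uIcc (-(R + 1)) (R + 1))).absolutelyContinuousOnInterval
  have hgAC : AbsolutelyContinuousOnInterval (fun x' => ψ (0, x')) (-(R + 1)) (R + 1) :=
    hgC.contDiffOn.absolutelyContinuousOnInterval
  have hga : ψ (0, -(R + 1)) = 0 := hψ0 _ (by rw [abs_neg, abs_of_pos (by linarith)]; linarith)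
  have hgb : ψ (0, R + 1) = 0 := hψ0 _ (by rw [abs_of_pos (by linarith)]; linarith)
  rw [e1, e2, hUAC.integral_mul_deriv_eq_deriv_mul hgAC, hga, hgb, mul_zero, mul_zero, sub_zero,
    zero_sub, neg_inj]
  -- `deriv U₀ = u₀` a.e.
  refine intervalIntegral.integral_congr_ae ?_
  have h0 : (0 : ℝ) ∈ uIcc (-(R + 1)) (R + 1) := by
    rw [uIcc_of_le hab]
    constructor <;> linarith
  filter_upwards [(intervalIntegrable_of_abs_le hm hM (-(R + 1)) (R + 1)).ae_hasDerivAt_integral]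
    with x hx hxab
  have hd := (hx (uIoc_subset_uIcc hxab) 0 h0).deriv
  change deriv (burgersPrimitive u₀) x * ψ (0, x) = u₀ x * ψ (0, x)
  rw [show burgersPrimitive u₀ = fun y => ∫ z in (0 : ℝ)..y, u₀ z from rfl, hd]

/-- **Hopf's solution is a weak solution of the Cauchy problem** (Hörmander Thm 2.4.2: `u`
"is a solution of (2.4.1)′"; Evans §3.4.2 Thm 1: the Lax–Oleinik formula gives an integral
solution), with `C¹` compactly supported test functions:
`∬_{t>0} (u ∂ₜψ + ½u² ∂ₓψ) dx dt + ∫ u₀(x) ψ(0,x) dx = 0`. Proof: from the potential `W`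
(`∂ₓW = u`, `∂ₜW = -u²/2` a.e., `W(0,·) = U₀`) by one difference quotient in `x`, Fubini and
integration by parts in `t`, instead of the printed vanishing-viscosity limit.
[cite: Hormander1997, Thm 2.4.2] -/
theorem hopfSolution_weakForm (hm : Measurable u₀) (hM : ∀ x, |u₀ x| ≤ M)
    (hψ : ContDiff ℝ 1 ψ) (hsupp : HasCompactSupport ψ) :
    (∫ t in Ioi (0 : ℝ), ∫ x : ℝ,
        (hopfSolution u₀ t x * deriv (fun t' => ψ (t', x)) t
          + 1 / 2 * hopfSolution u₀ t x ^ 2 * deriv (fun x' => ψ (t, x')) x))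
      + ∫ x : ℝ, u₀ x * ψ (0, x) = 0 := by
  obtain ⟨R, hR0, hR⟩ := exists_radius_of_hasCompactSupport hsupp
  have hψtc : Continuous fun p : ℝ × ℝ => fderiv ℝ ψ p (1, 0) :=
    (hψ.continuous_fderiv one_ne_zero).clm_apply continuous_const
  have hψxc : Continuous fun p : ℝ × ℝ => fderiv ℝ ψ p (0, 1) :=
    (hψ.continuous_fderiv one_ne_zero).clm_apply continuous_const
  have hψt0 : ∀ p : ℝ × ℝ, (R < |p.1| ∨ R < |p.2|) → fderiv ℝ ψ p (1, 0) = 0 := fun p hp => by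
    simp [(hR p hp).2]
  have hψx0 : ∀ p : ℝ × ℝ, (R < |p.1| ∨ R < |p.2|) → fderiv ℝ ψ p (0, 1) = 0 := fun p hp => by
    simp [(hR p hp).2]
  -- the limit identity `∬ u ψₜ = ∫ U₀ ψₓ(0,·) - ∬ (u²/2) ψₓ`
  have hlim := tendsto_integral_slope_hopfLaxPotential_mul hm hM hψ hsupp
  have hlimA := tendsto_integral_burgersPrimitive_mul_quotient hm hM hψ hsupp
  have hlimB := tendsto_integral_sq_mul_quotient hm hM hψ hsupp
  have heq : ∀ n : ℕ, (∫ t in Ioi (0 : ℝ), ∫ x,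
      (hopfLaxPotential u₀ t (x + 1 / ((n : ℝ) + 1)) - hopfLaxPotential u₀ t x)
        / (1 / ((n : ℝ) + 1)) * fderiv ℝ ψ (t, x) (1, 0))
      = -(∫ x, burgersPrimitive u₀ x
          * ((ψ (0, x - 1 / ((n : ℝ) + 1)) - ψ (0, x)) / (1 / ((n : ℝ) + 1))))
        + ∫ t in Ioi (0 : ℝ), ∫ x, hopfSolution u₀ t x ^ 2 / 2
          * ((ψ (t, x - 1 / ((n : ℝ) + 1)) - ψ (t, x)) / (1 / ((n : ℝ) + 1))) :=
    fun n => integral_slope_hopfLaxPotential_mul_eq hm hM hψ hsupp (by positivity)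
  have hlim' := (hlimA.neg.add hlimB).congr' (Eventually.of_forall fun n => (heq n).symm)
  have key := tendsto_nhds_unique hlim hlim'
  -- rewrite the goal with `fderiv` and split the inner and outer integrals
  have hu_m := measurable_uncurry_hopfSolution hm hM
  have hIt : Integrable (fun p : ℝ × ℝ => hopfSolution u₀ p.1 p.2 * fderiv ℝ ψ p (1, 0))
      (((volume : Measure ℝ).restrict (Ioi 0)).prod volume) :=
    integrable_prod_Ioi_of_bdd_mul hu_m (fun p => abs_hopfSolution_le hm hM p.1 p.2) hψtc hψt0
  have hu2m : Measurable fun p : ℝ × ℝ => 1 / 2 * hopfSolution u₀ p.1 p.2 ^ 2 :=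
    (hu_m.pow_const 2).const_mul _
  have hu2b : ∀ p : ℝ × ℝ, |1 / 2 * hopfSolution u₀ p.1 p.2 ^ 2| ≤ 1 / 2 * M ^ 2 := by
    intro p
    rw [abs_mul, abs_of_pos (by norm_num : (0 : ℝ) < 1 / 2), abs_pow]
    have := abs_hopfSolution_le hm hM p.1 p.2
    have h0 : 0 ≤ |hopfSolution u₀ p.1 p.2| := abs_nonneg _
    nlinarith
  have hIx : Integrable (fun p : ℝ × ℝ => 1 / 2 * hopfSolution u₀ p.1 p.2 ^ 2 * fderiv ℝ ψ p (0, 1))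
      (((volume : Measure ℝ).restrict (Ioi 0)).prod volume) :=
    integrable_prod_Ioi_of_bdd_mul hu2m hu2b hψxc hψx0
  have hderivs : ∀ t x, hopfSolution u₀ t x * deriv (fun t' => ψ (t', x)) t
      + 1 / 2 * hopfSolution u₀ t x ^ 2 * deriv (fun x' => ψ (t, x')) x
      = hopfSolution u₀ t x * fderiv ℝ ψ (t, x) (1, 0)
        + 1 / 2 * hopfSolution u₀ t x ^ 2 * fderiv ℝ ψ (t, x) (0, 1) := by
    intro t x
    rw [(hasDerivAt_testSlice_t hψ t x).deriv, (hasDerivAt_testSlice_x hψ t x).deriv]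
  simp_rw [hderivs]
  have hinner : ∀ᵐ t ∂(volume.restrict (Ioi (0 : ℝ))), ∫ x, (hopfSolution u₀ t x * fderiv ℝ ψ (t, x) (1, 0)
      + 1 / 2 * hopfSolution u₀ t x ^ 2 * fderiv ℝ ψ (t, x) (0, 1))
      = (∫ x, hopfSolution u₀ t x * fderiv ℝ ψ (t, x) (1, 0))
        + ∫ x, 1 / 2 * hopfSolution u₀ t x ^ 2 * fderiv ℝ ψ (t, x) (0, 1) := by
    filter_upwards [hIt.prod_right_ae, hIx.prod_right_ae] with t h1 h2
    exact integral_add h1 h2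
  rw [integral_congr_ae hinner, integral_add hIt.integral_prod_left hIx.integral_prod_left]
  have hB : ∫ t in Ioi (0 : ℝ), ∫ x, 1 / 2 * hopfSolution u₀ t x ^ 2 * fderiv ℝ ψ (t, x) (0, 1)
      = -∫ t in Ioi (0 : ℝ), ∫ x, hopfSolution u₀ t x ^ 2 / 2 * -fderiv ℝ ψ (t, x) (0, 1) := by
    rw [← MeasureTheory.integral_neg]
    refine congrArg (integral _) (funext fun t => ?_)
    rw [← MeasureTheory.integral_neg]
    refine congrArg (integral _) (funext fun x => ?_)
    ring
  have hA : ∫ x, burgersPrimitive u₀ x * -fderiv ℝ ψ (0, x) (0, 1)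
      = -∫ x, burgersPrimitive u₀ x * fderiv ℝ ψ (0, x) (0, 1) := by
    rw [← MeasureTheory.integral_neg]
    refine congrArg (integral _) (funext fun x => ?_)
    ring
  rw [hA, integral_burgersPrimitive_mul_deriv hm hM hψ hsupp] at key
  rw [hB]
  linarith

end WeakForm

end Literature.Analysis.PDE
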